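import Summits.KontsevichZagierPeriods.Zeta5Search.Certificates.PolyKronecker6

/-!
# ζ(2) two-tale line — kit for the kernel replay of the PARAMETRIC (bmiss) telescoping certificates (cell `pub-zeta5`, certifier `cert-2`)

HONEST FRAMING: systematic search; recurrence certificates; no irrationality claim unless certified.

fam-tele's parametric creative-telescoping proof of Zudilin's two-tale identity (bmiss) on the region `Ω`
(`certs/tele/bmiss_general/PROOF.md` §2, `certificates.json`) consists, for each step direction `δ` and each side
`X ∈ {L, R}`, of a polynomial identity in `ℤ[a,b,e,f,g,t]` ("cleared telescoping identity `Q = 0`") built from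
(i) PRODUCTS OF LINEAR FORMS `ℓ(a,b,e,f,g,t) = ℓ₀a + ℓ₁b + ℓ₂e + ℓ₃f + ℓ₄g + ℓ₅t + ℓ₆` (the Γ-ratios `F_X(p+kδ;t)/F_X(p;t)`,
`F_X(p;t+1)/F_X(p;t)` and the certificate's linear numerator/denominator factors) and (ii) SPARSE integer polynomials in
`a,b,e,f,g` (the operator `c₀..c₃` and the coefficients `x_j` of the certificate numerator `x = Σ_j x_j t^j`).
This file fixes the reflected syntax (`linE`, `linProdE`, `sparseE`, `polyTE`) with its semantics (`lval`, `lprod`, `spval`,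
`polyT`) so that the replay files `TwoTaleTelescope*.lean` state each identity over these NAMED atoms and prove it by ONE
Kronecker evaluation (`PolyKronecker6.peval_eq_zero_of_kron6`). General tooling; no named facts; nothing about irrationality.
-/

namespace Summit.KontsevichZagierPeriods.Zeta5Search.Certificates

namespace TwoTaleTelescope

open PolyReflect
open Lean.Grind.CommRing (Expr)

variable {R : Type*} [CommRing R]

/-! ### Linear forms and their products -/

/-- Value of the linear form with coefficient list `[ℓ₀,…,ℓ₅,ℓ₆]` at `(a,b,e,f,g,t)`: `ℓ₀a+ℓ₁b+ℓ₂e+ℓ₃f+ℓ₄g+ℓ₅t+ℓ₆`. -/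
def lval (L : List ℤ) (a b e f g t : R) : R :=
  (L.getD 0 0 : ℤ) * a + (L.getD 1 0 : ℤ) * b + (L.getD 2 0 : ℤ) * e + (L.getD 3 0 : ℤ) * f + (L.getD 4 0 : ℤ) * g
    + (L.getD 5 0 : ℤ) * t + ((L.getD 6 0 : ℤ) : R)

/-- Product of the values of a list of linear forms. -/
def lprod (fs : List (List ℤ)) (a b e f g t : R) : R := (fs.map fun L => lval L a b e f g t).prod

/-- `lprod` of the empty list. -/
@[simp] theorem lprod_nil (a b e f g t : R) : lprod [] a b e f g t = 1 := by simp [lprod]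
/-- `lprod` of a cons. -/
@[simp] theorem lprod_cons (L : List ℤ) (fs : List (List ℤ)) (a b e f g t : R) :
    lprod (L :: fs) a b e f g t = lval L a b e f g t * lprod fs a b e f g t := by simp [lprod]

/-- One term `c·vᵢ` of a linear form, OMITTED (as `0`) when `c = 0` so that the structural degree bounds `degB` of
`PolyKronecker6` only see the variables that really occur. -/
def linTermE (c : ℤ) (i : ℕ) : Expr := if c = 0 then .num 0 else .mul (.num c) (.var i)

/-- Semantics of `linTermE`. -/
theorem peval_linTermE (c : ℤ) (i : ℕ) (v : List R) : peval (linTermE c i) v = (c : R) * pvar v i := by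
  unfold linTermE
  split_ifs with h
  · rw [peval_num, h]; simp
  · rw [peval_mul, peval_num, peval_var]

/-- The linear form as a reflected expression (variables `v₀..v₅ = a,b,e,f,g,t`; zero coefficients omitted). -/
def linE (L : List ℤ) : Expr :=
  .add (.add (.add (.add (.add (.add (linTermE (L.getD 0 0) 0) (linTermE (L.getD 1 0) 1)) (linTermE (L.getD 2 0) 2))
    (linTermE (L.getD 3 0) 3)) (linTermE (L.getD 4 0) 4)) (linTermE (L.getD 5 0) 5)) (.num (L.getD 6 0))

/-- The product of linear forms as a reflected expression. -/
def linProdE : List (List ℤ) → Expr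
  | [] => .num 1
  | L :: fs => .mul (linE L) (linProdE fs)

/-- Semantics of `linE`. -/
theorem peval_linE (L : List ℤ) (a b e f g t : R) : peval (linE L) [a, b, e, f, g, t] = lval L a b e f g t := by
  have d0 : pvar [a, b, e, f, g, t] 0 = a := rfl
  have d1 : pvar [a, b, e, f, g, t] 1 = b := rfl
  have d2 : pvar [a, b, e, f, g, t] 2 = e := rfl
  have d3 : pvar [a, b, e, f, g, t] 3 = f := rfl
  have d4 : pvar [a, b, e, f, g, t] 4 = g := rfl
  have d5 : pvar [a, b, e, f, g, t] 5 = t := rfl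
  simp only [linE, peval_add, peval_linTermE, peval_num, d0, d1, d2, d3, d4, d5, lval]

/-- Semantics of `linProdE`. -/
theorem peval_linProdE (a b e f g t : R) : ∀ fs : List (List ℤ), peval (linProdE fs) [a, b, e, f, g, t] = lprod fs a b e f g t
  | [] => by rw [linProdE, peval_num, lprod_nil]; simp
  | L :: fs => by rw [linProdE, peval_mul, peval_linE, peval_linProdE a b e f g t fs, lprod_cons]

/-! ### Sparse polynomials in the five parameters -/

/-- Value of a sparse polynomial `Σ c·a^i b^j e^k f^l g^m` (terms `(c,i,j,k,l,m)`). -/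
def spval (d : List (ℤ × ℕ × ℕ × ℕ × ℕ × ℕ)) (a b e f g : R) : R :=
  (d.map fun x => (x.1 : R) * a ^ x.2.1 * b ^ x.2.2.1 * e ^ x.2.2.2.1 * f ^ x.2.2.2.2.1 * g ^ x.2.2.2.2.2).sum

/-- `spval` of the empty list. -/
@[simp] theorem spval_nil (a b e f g : R) : spval [] a b e f g = 0 := by simp [spval]
/-- `spval` of a cons. -/
@[simp] theorem spval_cons (x : ℤ × ℕ × ℕ × ℕ × ℕ × ℕ) (d : List (ℤ × ℕ × ℕ × ℕ × ℕ × ℕ)) (a b e f g : R) :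
    spval (x :: d) a b e f g =
      (x.1 : R) * a ^ x.2.1 * b ^ x.2.2.1 * e ^ x.2.2.2.1 * f ^ x.2.2.2.2.1 * g ^ x.2.2.2.2.2 + spval d a b e f g := by
  simp [spval]

/-- One monomial as a reflected expression. -/
def monoE (x : ℤ × ℕ × ℕ × ℕ × ℕ × ℕ) : Expr :=
  .mul (.mul (.mul (.mul (.mul (.num x.1) (.pow (.var 0) x.2.1)) (.pow (.var 1) x.2.2.1)) (.pow (.var 2) x.2.2.2.1))
    (.pow (.var 3) x.2.2.2.2.1)) (.pow (.var 4) x.2.2.2.2.2)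

/-- The sparse polynomial as a reflected expression. -/
def sparseE : List (ℤ × ℕ × ℕ × ℕ × ℕ × ℕ) → Expr
  | [] => .num 0
  | x :: d => .add (monoE x) (sparseE d)

/-- Semantics of `monoE`. -/
theorem peval_monoE (x : ℤ × ℕ × ℕ × ℕ × ℕ × ℕ) (a b e f g t : R) :
    peval (monoE x) [a, b, e, f, g, t] = (x.1 : R) * a ^ x.2.1 * b ^ x.2.2.1 * e ^ x.2.2.2.1 * f ^ x.2.2.2.2.1 * g ^ x.2.2.2.2.2 := by
  have d0 : pvar [a, b, e, f, g, t] 0 = a := rfl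
  have d1 : pvar [a, b, e, f, g, t] 1 = b := rfl
  have d2 : pvar [a, b, e, f, g, t] 2 = e := rfl
  have d3 : pvar [a, b, e, f, g, t] 3 = f := rfl
  have d4 : pvar [a, b, e, f, g, t] 4 = g := rfl
  simp only [monoE, peval_mul, peval_pow, peval_num, peval_var, d0, d1, d2, d3, d4]

/-- Semantics of `sparseE`. -/
theorem peval_sparseE (a b e f g t : R) :
    ∀ d : List (ℤ × ℕ × ℕ × ℕ × ℕ × ℕ), peval (sparseE d) [a, b, e, f, g, t] = spval d a b e f g
  | [] => by rw [sparseE, peval_num, spval_nil]; simp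
  | x :: d => by rw [sparseE, peval_add, peval_monoE, peval_sparseE a b e f g t d, spval_cons]

/-! ### Packed terms: one natural number per monomial (fast elaboration of large data) -/

/-- Decode a packed term `N = (c + 2^64)·64⁵ + i·64⁴ + j·64³ + k·64² + l·64 + m` into `(c, i, j, k, l, m)`. -/
def unpackT (n : ℕ) : ℤ × ℕ × ℕ × ℕ × ℕ × ℕ :=
  (((n / 1073741824 : ℕ) : ℤ) - 18446744073709551616, n / 16777216 % 64, n / 262144 % 64, n / 4096 % 64, n / 64 % 64, n % 64)

/-- Value of a packed sparse polynomial. -/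
def spvalN (d : List ℕ) (a b e f g : R) : R := spval (d.map unpackT) a b e f g

/-- A packed sparse polynomial as a reflected expression. -/
def sparseNE (d : List ℕ) : Expr := sparseE (d.map unpackT)

/-- Semantics of `sparseNE`. -/
theorem peval_sparseNE (d : List ℕ) (a b e f g t : R) : peval (sparseNE d) [a, b, e, f, g, t] = spvalN d a b e f g := by
  rw [sparseNE, peval_sparseE, spvalN]

/-- Value of a CHUNKED packed sparse polynomial (list of chunks; chunking keeps the reflected tree shallow). -/
def spvalC (dd : List (List ℕ)) (a b e f g : R) : R := (dd.map fun d => spvalN d a b e f g).sum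

/-- A chunked packed sparse polynomial as a reflected expression (depth ≤ #chunks + chunk length). -/
def sparseCE : List (List ℕ) → Expr
  | [] => .num 0
  | d :: dd => .add (sparseNE d) (sparseCE dd)

/-- Semantics of `sparseCE`. -/
theorem peval_sparseCE (a b e f g t : R) : ∀ dd : List (List ℕ), peval (sparseCE dd) [a, b, e, f, g, t] = spvalC dd a b e f g
  | [] => by rw [sparseCE, peval_num]; simp [spvalC]
  | d :: dd => by
      rw [sparseCE, peval_add, peval_sparseNE, peval_sparseCE a b e f g t dd]; simp [spvalC]

/-- `polyTN xs s = Σ_j spvalC xs[j] · (t+s)^j` — the certificate numerator `x(p, t+s)` from chunked packed data. -/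
def polyTN (xs : List (List (List ℕ))) (s : ℤ) (a b e f g t : R) : R :=
  ((List.range xs.length).map fun j => spvalC (xs.getD j []) a b e f g * (t + (s : R)) ^ j).sum

/-- `polyTN` as a reflected expression. -/
def polyTNE (xs : List (List (List ℕ))) (s : ℤ) : Expr :=
  (List.range xs.length).foldr (fun j acc => .add (.mul (sparseCE (xs.getD j [])) (.pow (.add (.var 5) (.num s)) j)) acc)
    (.num 0)

/-- Semantics of `polyTNE` (auxiliary, over an index list). -/
theorem peval_polyTNE_aux (xs : List (List (List ℕ))) (s : ℤ) (a b e f g t : R) :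
    ∀ js : List ℕ, peval (js.foldr (fun j acc => Expr.add (.mul (sparseCE (xs.getD j [])) (.pow (.add (.var 5) (.num s)) j)) acc)
      (.num 0)) [a, b, e, f, g, t] = (js.map fun j => spvalC (xs.getD j []) a b e f g * (t + (s : R)) ^ j).sum
  | [] => by simp [peval_num]
  | j :: js => by
      have d5 : pvar [a, b, e, f, g, t] 5 = t := rfl
      rw [List.foldr_cons, peval_add, peval_mul, peval_sparseCE, peval_pow, peval_add, peval_var, d5, peval_num,
        peval_polyTNE_aux xs s a b e f g t js, List.map_cons, List.sum_cons]

/-- Semantics of `polyTNE`. -/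
theorem peval_polyTNE (xs : List (List (List ℕ))) (s : ℤ) (a b e f g t : R) :
    peval (polyTNE xs s) [a, b, e, f, g, t] = polyTN xs s a b e f g t := by
  rw [polyTNE, peval_polyTNE_aux, polyTN]

/-! ### Polynomials in `t` (or `t+1`) with sparse coefficients -/

/-- `polyT xs s = Σ_j spval xs[j] · (t+s)^j` — the certificate numerator `x(p, t+s)`. -/
def polyT (xs : List (List (ℤ × ℕ × ℕ × ℕ × ℕ × ℕ))) (s : ℤ) (a b e f g t : R) : R :=
  ((List.range xs.length).map fun j => spval (xs.getD j []) a b e f g * (t + (s : R)) ^ j).sum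

/-- `polyT` as a reflected expression: Horner-free sum `Σ_j sparseE xs[j] · (v₅ + s)^j` over an explicit index list. -/
def polyTE (xs : List (List (ℤ × ℕ × ℕ × ℕ × ℕ × ℕ))) (s : ℤ) : Expr :=
  (List.range xs.length).foldr (fun j acc => .add (.mul (sparseE (xs.getD j [])) (.pow (.add (.var 5) (.num s)) j)) acc)
    (.num 0)

/-- Semantics of `polyTE` (auxiliary, over an index list). -/
theorem peval_polyTE_aux (xs : List (List (ℤ × ℕ × ℕ × ℕ × ℕ × ℕ))) (s : ℤ) (a b e f g t : R) :
    ∀ js : List ℕ, peval (js.foldr (fun j acc => Expr.add (.mul (sparseE (xs.getD j [])) (.pow (.add (.var 5) (.num s)) j)) acc)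
      (.num 0)) [a, b, e, f, g, t] = (js.map fun j => spval (xs.getD j []) a b e f g * (t + (s : R)) ^ j).sum
  | [] => by simp [peval_num]
  | j :: js => by
      have d5 : pvar [a, b, e, f, g, t] 5 = t := rfl
      rw [List.foldr_cons, peval_add, peval_mul, peval_sparseE, peval_pow, peval_add, peval_var, d5, peval_num,
        peval_polyTE_aux xs s a b e f g t js, List.map_cons, List.sum_cons]

/-- Semantics of `polyTE`. -/
theorem peval_polyTE (xs : List (List (ℤ × ℕ × ℕ × ℕ × ℕ × ℕ))) (s : ℤ) (a b e f g t : R) :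
    peval (polyTE xs s) [a, b, e, f, g, t] = polyT xs s a b e f g t := by
  rw [polyTE, peval_polyTE_aux, polyT]

end TwoTaleTelescope

end Summit.KontsevichZagierPeriods.Zeta5Search.Certificates
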